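import Literature.MathematicalPhysics.QuantumFieldTheory.Balaban1983to89.B9Thm313WholeDir
import Literature.MathematicalPhysics.QuantumFieldTheory.Balaban1983to89.B9Thm313WholeInputZ

/-!
# `Balaban1983to89.B9Thm313WholeDirZ` — [B9] Theorem 3.13 (p. 426), DIRECTION-INDEXED: the left sup entry (3.42)₂ of 𝔊 per component, with the
# COARSE-FIELD LETTERS RE-CLASSED (Z-twin of the sup part of `B9Thm313WholeDir`; R1-cls of the cell's located «C-LETTER-FLAT-AT-ONE»)

T. Bałaban, *Propagators for lattice gauge theories in a background field*, Commun. Math. Phys. **99** (1985) 389–434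
[`Balaban1985BackgroundPropagators`, "B9"]; [4] = T. Bałaban, *Propagators and renormalization transformations for lattice
gauge theories. II*, Commun. Math. Phys. **96** (1984) 223–250 [`Balaban1984PropagatorsII`].  statement-level skeleton of published
theorems with citation tags; proofs where landed; nothing here is a claim about the Yang–Mills mass gap.

THE POINT.  `B9Thm313WholeDir.GG_entry1E_of_letters ∕ GG_entry1d_of_letters` read the factorisation (E G₁Q\*)·(QG₁Q\*)⁻¹·(QG₁) through the FLAT coarse
class Z⁰, located unsatisfiable at the knit's flat pins.  Here, as in `B9Thm313WholeZ ∕ LeftZ ∕ HolderZ ∕ InputZ`, the middle class is the weighted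
sharp-block class `Z_{wZ} = weightNorm (ofBlocks blkZ) wZ` (one free positive weight):
* §1 `Letters313DMZ 𝔬 𝔭 Dd R₀ H₀ hG wZ hwZ B₃ Bq δ₃ bH U` — `Letters313DM` with `dgQsd ∕ pQd` sourced at `Z_{wZ}` (`dgDHd` unchanged);
* §2 ★ `GG_entry1E_of_lettersZ` (`hEQ` out of `Z_{wZ}`, `hL : Letters313Z`), ★ `GG_entry1d_of_lettersZ` (over `Letters313Z ∕ Letters313DZ ∕ Letters313DMZ`)
  — SAME conclusions and constants `constD313 …`; proofs verbatim (`hasMaj_right_of_step_weight`, cutting cost `weightNorm_ofBlocks_κ = 1`).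
The block-L² members of `B9Thm313WholeDir` (§3 there, letters `Letters313L2P ∕ L2M`) are not touched here.  `wZ ≡ 1` recovers the flat statements.

HONEST SCOPE.  Nothing of print is asserted: the letters are HYPOTHESES of printed ∕ md shape; kernel-checked bookkeeping.  NOT a node discharge, NOT
summit progress; one finite lattice at a time; nothing continuum, nothing about the mass gap.  Cell `pub-ymgap` (HUMAN RULING D-0062), Track A node
N06 [B9], N06-ASSIGNMENT v1 row 21 (bundle F7), seat `pub-ymgap-dag-n06-l` (g14), 2026-08-27.  NEW file; nothing landed is modified.
-/

namespace Literature.MathematicalPhysics.QuantumFieldTheory.Balaban1983to89.B9Thm313WholeDirZ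

open Literature.MathematicalPhysics.QuantumFieldTheory.Balaban1983to89
open Finset B6RandomWalk B6RandomWalkHom B9Thm34Ext B9Thm37GlueCor36 B11SectG B9SectDSup
open B9Thm37AllNorms B9Thm37AllNormsInstances B9FromB6 B9SectBStepWhole B9Thm312Whole B9Thm312WholeLeaf
open B9Thm312WholeLeft B9Thm313Whole B9Thm313WholeLeft
open B9Thm37Glue B9SectDL2Decay B9RWSums343Holder B9Ineq347 B9Thm312WholeClasses B9Thm312WholeL2
open B9Thm312WholeBlocksRel B9Thm312WholeBlocksNbr B9Thm312WholeHolder B9Thm312WholeHHolder B9Thm313WholeHolder B9Thm313WholeL2G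
open B9Thm313WholeL2GP B9RWSums346SecondDiff B9Thm312WholeDir B9Thm313WholeDir
open B9Thm313WholeZ B9Thm313WholeLeftZ B9Thm313WholeHolderZ B9Thm313WholeInputZ

noncomputable section

section OneMember

variable {g : B9.Geometry} {B : B9.Backgrounds} {X Y Z W PX PY P : Type}
variable [Fintype X] [Fintype Y] [Fintype Z] [Fintype W] [Fintype PX] [Fintype PY] [Fintype P] [Fintype g.Site]
variable {R₀ : ℝ} {H₀ : Prop}

/-! ## §1 The direction-indexed ∇-letters, coarse class re-weighted (printed shape; nothing asserted) -/

/-- **THE SUP- AND PROBE-CLASS LETTERS OF THE REDUCTION, PER LEFT DIRECTION, COARSE CLASS RE-WEIGHTED** (`B9Thm313WholeDir.Letters313DM` with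
`dgQsd ∕ pQd` sourced at `Z_{wZ} = weightNorm (ofBlocks blkZ) wZ`) — the direction twins of `B9Thm313WholeLeftZ.Letters313DZ.dgQs ∕ dgDH` and
`B9Thm312WholeHZ.LettersHHZ.pQ` (there for the bundled ∇_U): `dgQsd ν` — ∇_{U,ν}G₀Q\* : Z_{wZ} → 𝔠⁽¹⁾ (an H₀-type entry of (3.126)); `dgDHd ν` —
∇_{U,ν}G₀Dv out of the free W-Hölder class `bH` into 𝔠⁽¹⁾ (the gauge-mode derivative Dv of DvRDv\*, [4] (2.26); the twice-differentiated term read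
from a Hölder input as in (3.44)); `pQd ν β` — the Φ^X_β-probe of ∇_{U,ν}G₀Q\* from Z_{wZ} into the probe class of weight (Lʲη)^{β−1}.  NOTHING ASSERTED:
these are the instance's (Theorem 3.3 for G₀, (3.126), (3.49)). [cite: Balaban1985BackgroundPropagators, Thm 3.13 p.426 + (3.126) p.420 + (3.42)–(3.44) pp.397–398 + (3.40) p.397 + (3.39) p.397; Balaban1984PropagatorsII, (2.26) p.228] -/
structure Letters313DMZ (𝔬 : Ops g B X Y Z W) (𝔭 : HolderProbes g B X Y PX PY) (Dd : B.Cfg → P → Module.End ℝ (X → ℝ))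
    (R₀ : ℝ) (H₀ : Prop) (hG : GeoOK g) (wZ : g.Site → ℝ) (hwZ : ∀ y, 0 < wZ y) (B₃ : ℝ) (Bq : ℝ → ℝ) (δ₃ : ℝ)
    (bH : BlockNorm (toB6 g R₀ H₀) (W → ℝ)) (U : B.Cfg) : Prop where
  dgQsd : ∀ ν : P, HasMaj (weightNorm (BlockNorm.ofBlocks (toB6 g R₀ H₀) 𝔬.blkZ) wZ fun y => (hwZ y).le) (cNorm R₀ H₀ 𝔬.blk hG.lenle 1)
    (Dd U ν ∘ₗ 𝔬.G0 U ∘ₗ 𝔬.Qstar U) (fun a b => B₃ * Real.exp (-(δ₃ * g.dist a b)))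
  dgDHd : ∀ ν : P, HasMaj bH (cNorm R₀ H₀ 𝔬.blk hG.lenle 1) (Dd U ν ∘ₗ 𝔬.G0 U ∘ₗ 𝔬.Dv U)
    (fun a b => B₃ * Real.exp (-(δ₃ * g.dist a b)))
  pQd : ∀ (ν : P) (β : ℝ), 0 ≤ β → β < 1 → HasMaj (weightNorm (BlockNorm.ofBlocks (toB6 g R₀ H₀) 𝔬.blkZ) wZ fun y => (hwZ y).le)
    (cNormR R₀ H₀ 𝔭.blkPX hG.lenle (β - 1)) ((𝔭.ΦX U β ∘ₗ Dd U ν ∘ₗ 𝔬.G0 U) ∘ₗ 𝔬.Qstar U)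
    (fun a b => Bq β * Real.exp (-(δ₃ * g.dist a b)))

/-! ## §2 One member, one U: E𝔊 and ∇_{U,ν}𝔊 over the re-classed letters -/

/-- ★ **THEOREM 3.13, A LEFT ENTRY E𝔊 WITH A GENERIC LEFT LETTER, PRINTED SHAPE, COARSE LETTERS RE-CLASSED** (statement of
`B9Thm313WholeDir.GG_entry1E_of_letters` over `Letters313Z`, `hEQ` out of `Z_{wZ}`; the abstraction of `B9Thm313WholeLeftZ.GG_entry1_of_lettersZ` from
∇_U to any E : 𝔩(X) → 𝔩(V′) with block map `blkE`): from Theorem 3.3's (3.42)₁ (`he0`) for G₀ and the E-entry of G₀ (`he1E`, majorant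
B₀Lʲη·e^{−δ₀d}), the step K′₁ = G₀(Δ′_π + Δ⁽²⁾_π) on 𝔠⁽²⁾ (`hK`, θc < 1) and its E-derivative E∘G₀∘T₁ : 𝔠⁽²⁾ → 𝔠_E⁽¹⁾ (`hKE`, θ′), the letters `gD2`,
`gQs2`, `rgd2`, `c1_2`, `q2` of `Letters313Z`, the E-letters E∘G₀∘Q\* : Z_{wZ} → 𝔠_E⁽¹⁾ (`hEQ`) and E∘G₀∘Dv : `bH` → 𝔠_E⁽¹⁾ (`hEDH`), `rgdH`, and (3.153)
(`E_GG_eq`): E𝔊 has the two-space sup majorant C·Lʲη·e^{−ρ′d}, C = `constD313 (B₀ + θ′·B₀(1−θc)⁻¹·c) θ′ (B₀(1−θc)⁻¹) (B₃(1−θc)⁻¹) B₃ κ_H c`, for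
every ρ′ ≧ 0 with ρ′ + 3σ ≦ ρ (ρ ≦ δ₀, ρ ≦ δ₃, ρ + σ ≦ δ_K). [cite: Balaban1985BackgroundPropagators, Thm 3.13 p.426 + (3.152)–(3.153) p.426 + (3.138) p.423 + (3.42)–(3.44) pp.397–398; Balaban1984PropagatorsII, (2.54) p.232 + Lemma 2.1 (2.61) p.234] -/
theorem GG_entry1E_of_lettersZ (hG : GeoOK g) {𝔬 : Ops g B X Y Z W} {U : B.Cfg} {V' : Type} [Fintype V']
    {blkE : V' → g.Site} {E : (X → ℝ) →ₗ[ℝ] (V' → ℝ)} {bH : BlockNorm (toB6 g R₀ H₀) (W → ℝ)}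
    {θ θ' B₀ B₃ δ₀ δ₃ δK ρ ρ' σ c : ℝ} (hrow : RowSum (toB6 g R₀ H₀) σ c) (hc : 0 ≤ c)
    (hθ : 0 ≤ θ) (hθ' : 0 ≤ θ') (hB₀ : 0 ≤ B₀) (hB₃ : 0 ≤ B₃) (hσ : 0 ≤ σ) (hρ' : 0 ≤ ρ') (hρ'ρ : ρ' + 3 * σ ≤ ρ) (hρS : ρ ≤ δ₀)
    (hρ₃ : ρ ≤ δ₃) (hρδ : ρ + σ ≤ δK) (hq : θ * c < 1)
    (hK : HasMaj (cNorm R₀ H₀ 𝔬.blk hG.lenle 2) (cNorm R₀ H₀ 𝔬.blk hG.lenle 2) (𝔬.G0 U ∘ₗ (𝔬.Tpi U + 𝔬.T2 U))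
      (fun a b => θ * Real.exp (-(δK * g.dist a b))))
    (he0 : HasMajorant (g := toB6 g R₀ H₀) 𝔬.blk (𝔬.G0 U) (fun a b => B₀ * g.len a ^ 2 * Real.exp (-(δ₀ * g.dist a b))))
    (he1E : HasMajorantHom (g := toB6 g R₀ H₀) 𝔬.blk blkE (E ∘ₗ 𝔬.G0 U)
      (fun (a b : g.Site) => B₀ * g.len a * Real.exp (-(δ₀ * g.dist a b))))
    (hKE : HasMaj (cNorm R₀ H₀ 𝔬.blk hG.lenle 2) (cNorm R₀ H₀ blkE hG.lenle 1) (E ∘ₗ 𝔬.G0 U ∘ₗ (𝔬.Tpi U + 𝔬.T2 U))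
      (fun a b => θ' * Real.exp (-(δK * g.dist a b))))
    {wZ : g.Site → ℝ} {hwZ : ∀ y, 0 < wZ y}
    (hEQ : HasMaj (weightNorm (BlockNorm.ofBlocks (toB6 g R₀ H₀) 𝔬.blkZ) wZ fun y => (hwZ y).le) (cNorm R₀ H₀ blkE hG.lenle 1) (E ∘ₗ 𝔬.G0 U ∘ₗ 𝔬.Qstar U)
      (fun a b => B₃ * Real.exp (-(δ₃ * g.dist a b))))
    (hEDH : HasMaj bH (cNorm R₀ H₀ blkE hG.lenle 1) (E ∘ₗ 𝔬.G0 U ∘ₗ 𝔬.Dv U) (fun a b => B₃ * Real.exp (-(δ₃ * g.dist a b))))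
    (hL : Letters313Z 𝔬 R₀ H₀ hG wZ hwZ B₃ δ₃ U)
    (hrgdH : HasMaj (cNorm R₀ H₀ 𝔬.blk hG.lenle 0) bH (𝔬.R U ∘ₗ 𝔬.Dvstar U ∘ₗ 𝔬.G1 U ∘ₗ LinearMap.id)
      (fun a b => B₃ * Real.exp (-(δ₃ * g.dist a b))))
    (hI : Identities 𝔬 U) :
    HasMajorantHom (g := toB6 g R₀ H₀) 𝔬.blk blkE (E ∘ₗ 𝔬.GG U)
      (fun a b => constD313 (B₀ + θ' * (B₀ * (1 - θ * c)⁻¹) * c) θ' (B₀ * (1 - θ * c)⁻¹) (B₃ * (1 - θ * c)⁻¹) B₃ bH.κ c *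
        g.len a * Real.exp (-(ρ' * g.dist a b))) := by
  -- adapted from `B9Thm313WholeLeftZ.GG_entry1_of_lettersZ` (∇_U ↦ E, `D_GG_eq` ↦ `E_GG_eq`)
  have hq1 : 0 ≤ (1 - θ * c)⁻¹ := inv_nonneg.mpr (by linarith)
  have hA₁ : 0 ≤ B₀ * (1 - θ * c)⁻¹ := mul_nonneg hB₀ hq1
  have hA₃ : 0 ≤ B₃ * (1 - θ * c)⁻¹ := mul_nonneg hB₃ hq1
  have hCL : 0 ≤ B₀ + θ' * (B₀ * (1 - θ * c)⁻¹) * c := add_nonneg hB₀ (mul_nonneg (mul_nonneg hθ' hA₁) hc)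
  have hfix1 := fix_of_inverses hI.invG0' hI.invG1
  have hρ0 : 0 ≤ ρ := by linarith
  have htri : Triangle254 (toB6 g R₀ H₀) := fun a b c => hG.tri a b c
  -- (a) the right entries of G₁: G₁ : 𝔠⁽⁰⁾ → 𝔠⁽²⁾, G₁Dv : W¹ → 𝔠⁽²⁾, G₁Q* : Z_{wZ} → 𝔠⁽²⁾
  have hG1 : HasMaj (cNorm R₀ H₀ 𝔬.blk hG.lenle 0) (cNorm R₀ H₀ 𝔬.blk hG.lenle 2) (𝔬.G1 U ∘ₗ LinearMap.id)
      (fun a b => B₀ * (1 - θ * c)⁻¹ * Real.exp (-(ρ * g.dist a b))) := by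
    rw [LinearMap.comp_id]
    exact hasMaj_entry0_cNorm hG hrow hθ hB₀ hρ0 hρS hρδ hK he0 hfix1 hq
  have hGD := hasMaj_right_of_step hG hrow hθ hB₃ hρ0 hρ₃ hρδ hK hL.gD2 hfix1 hq
  have hGQ := hasMaj_right_of_step_weight hG hwZ hrow hθ hB₃ hρ0 hρ₃ hρδ hK hL.gQs2 hfix1 hq
  -- (b) the left-and-right entries EG₁ : 𝔠⁽⁰⁾ → 𝔠_E⁽¹⁾ at the rate ρ
  have h10 : HasMaj (BlockNorm.ofBlocks (toB6 g R₀ H₀) 𝔬.blk) (BlockNorm.ofBlocks (toB6 g R₀ H₀) blkE) (E ∘ₗ 𝔬.G0 U)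
      (fun a b => B₀ * g.len a * Real.exp (-(δ₀ * g.dist a b))) :=
    hasMaj_of_hasMajorantHom (G := toB6 g R₀ H₀) 𝔬.blk blkE
      (fun a b => mul_nonneg (mul_nonneg hB₀ (hG.lenle a)) (Real.exp_nonneg _)) he1E
  have hE0 : HasMaj (cNorm R₀ H₀ 𝔬.blk hG.lenle 0) (cNorm R₀ H₀ blkE hG.lenle 1) (E ∘ₗ 𝔬.G0 U ∘ₗ LinearMap.id)
      (fun a b => B₀ * Real.exp (-(δ₀ * g.dist a b))) := by
    rw [LinearMap.comp_id]
    refine (hasMaj_cNorm_of_hasMaj hG 1 0 h10).mono fun y y' => le_of_eq ?_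
    have hy : g.len y ≠ 0 := (hG.lenpos y).ne'
    simp only [wt, pow_zero, pow_one, mul_one]
    rw [mul_assoc B₀, mul_comm (g.len y), ← mul_assoc B₀, mul_assoc, mul_inv_cancel₀ hy, mul_one]
  have hD1 : HasMaj (cNorm R₀ H₀ 𝔬.blk hG.lenle 0) (cNorm R₀ H₀ blkE hG.lenle 1) (E ∘ₗ 𝔬.G1 U ∘ₗ LinearMap.id)
      (fun y y' => (B₀ + θ' * (B₀ * (1 - θ * c)⁻¹) * c) * Real.exp (-(ρ * g.dist y y'))) :=
    hasMaj_left_right hG hrow hθ' hB₀ hA₁ hρ0 hρS le_rfl hρδ hKE hE0 hG1 hfix1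
  -- (c) TERM B = (EG₁Dv)(RDv*G₁) = (EG₀Dv)(RDv*G₁) + ((EG₀T₁)(G₁Dv))(RDv*G₁)
  have hρ'₃ : ρ' ≤ δ₃ := by linarith
  have hρ'σ₃ : ρ' + σ ≤ δ₃ := by linarith
  have hB1 : HasMaj (cNorm R₀ H₀ 𝔬.blk hG.lenle 0) (cNorm R₀ H₀ blkE hG.lenle 1)
      ((E ∘ₗ 𝔬.G0 U ∘ₗ 𝔬.Dv U) ∘ₗ (𝔬.R U ∘ₗ 𝔬.Dvstar U ∘ₗ 𝔬.G1 U ∘ₗ LinearMap.id))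
      (fun y y' => bH.κ * B₃ * B₃ * c * Real.exp (-(ρ' * g.dist y y'))) :=
    hasMaj_comp_exp htri hG.dnn hrow hB₃ hB₃ hρ' hρ'₃ hρ'σ₃ hEDH hrgdH
  have hGDT : HasMaj (cNorm R₀ H₀ 𝔬.blkW hG.lenle 1) (cNorm R₀ H₀ blkE hG.lenle 1)
      ((E ∘ₗ 𝔬.G0 U ∘ₗ (𝔬.Tpi U + 𝔬.T2 U)) ∘ₗ (𝔬.G1 U ∘ₗ 𝔬.Dv U))
      (fun y y' => (cNorm R₀ H₀ 𝔬.blk hG.lenle 2 (X := X)).κ * θ' * (B₃ * (1 - θ * c)⁻¹) * c *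
        Real.exp (-((ρ' + σ) * g.dist y y'))) :=
    hasMaj_comp_exp htri hG.dnn hrow hθ' hA₃ (by linarith) (by linarith) (by linarith) hKE hGD
  simp only [cNorm_κ, one_mul] at hGDT
  have hθA₃ : 0 ≤ θ' * (B₃ * (1 - θ * c)⁻¹) * c := mul_nonneg (mul_nonneg hθ' hA₃) hc
  have hB2 : HasMaj (cNorm R₀ H₀ 𝔬.blk hG.lenle 0) (cNorm R₀ H₀ blkE hG.lenle 1)
      (((E ∘ₗ 𝔬.G0 U ∘ₗ (𝔬.Tpi U + 𝔬.T2 U)) ∘ₗ (𝔬.G1 U ∘ₗ 𝔬.Dv U)) ∘ₗ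
        (𝔬.R U ∘ₗ 𝔬.Dvstar U ∘ₗ 𝔬.G1 U ∘ₗ LinearMap.id))
      (fun y y' => (cNorm R₀ H₀ 𝔬.blkW hG.lenle 1 (X := W)).κ * (θ' * (B₃ * (1 - θ * c)⁻¹) * c) * B₃ * c *
        Real.exp (-(ρ' * g.dist y y'))) :=
    hasMaj_comp_exp htri hG.dnn hrow hθA₃ hB₃ hρ' hρ'₃ le_rfl hGDT hL.rgd2
  simp only [cNorm_κ, one_mul] at hB2
  have eB : (E ∘ₗ 𝔬.G1 U ∘ₗ 𝔬.Dv U) ∘ₗ (𝔬.R U ∘ₗ 𝔬.Dvstar U ∘ₗ 𝔬.G1 U ∘ₗ LinearMap.id) =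
      (E ∘ₗ 𝔬.G0 U ∘ₗ 𝔬.Dv U) ∘ₗ (𝔬.R U ∘ₗ 𝔬.Dvstar U ∘ₗ 𝔬.G1 U ∘ₗ LinearMap.id) +
        (((E ∘ₗ 𝔬.G0 U ∘ₗ (𝔬.Tpi U + 𝔬.T2 U)) ∘ₗ (𝔬.G1 U ∘ₗ 𝔬.Dv U)) ∘ₗ
          (𝔬.R U ∘ₗ 𝔬.Dvstar U ∘ₗ 𝔬.G1 U ∘ₗ LinearMap.id)) := by
    rw [comp_fix_left_right E (𝔬.Dv U) hfix1, LinearMap.add_comp]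
  have hB := hB1.add hB2
  rw [← eB] at hB
  -- (d) TERM C = (EG₁Q*)((QG₁Q*)⁻¹QG₁) through the sup classes Z², Z⁰
  have hQG : HasMaj (cNorm R₀ H₀ 𝔬.blk hG.lenle 0) (cNorm R₀ H₀ 𝔬.blkZ hG.lenle 2) (𝔬.Q U ∘ₗ (𝔬.G1 U ∘ₗ LinearMap.id))
      (fun a b => (cNorm R₀ H₀ 𝔬.blk hG.lenle 2 (X := X)).κ * B₃ * (B₀ * (1 - θ * c)⁻¹) * c *
        Real.exp (-((ρ' + 2 * σ) * g.dist a b))) :=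
    hasMaj_comp_exp htri hG.dnn hrow hB₃ hA₁ (by linarith) (by linarith) (by linarith) hL.q2 hG1
  simp only [cNorm_κ, one_mul] at hQG
  have hK₁ : 0 ≤ B₃ * (B₀ * (1 - θ * c)⁻¹) * c := mul_nonneg (mul_nonneg hB₃ hA₁) hc
  have hCQG : HasMaj (cNorm R₀ H₀ 𝔬.blk hG.lenle 0) (weightNorm (BlockNorm.ofBlocks (toB6 g R₀ H₀) 𝔬.blkZ) wZ fun y => (hwZ y).le)
      (𝔬.C1 U ∘ₗ (𝔬.Q U ∘ₗ (𝔬.G1 U ∘ₗ LinearMap.id)))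
      (fun a b => (cNorm R₀ H₀ 𝔬.blkZ hG.lenle 2 (X := Z)).κ * B₃ * (B₃ * (B₀ * (1 - θ * c)⁻¹) * c) * c *
        Real.exp (-((ρ' + σ) * g.dist a b))) :=
    hasMaj_comp_exp htri hG.dnn hrow hB₃ hK₁ (by linarith) (by linarith) (by linarith) hL.c1_2 hQG
  simp only [cNorm_κ, one_mul] at hCQG
  have hD1Q : HasMaj (weightNorm (BlockNorm.ofBlocks (toB6 g R₀ H₀) 𝔬.blkZ) wZ fun y => (hwZ y).le) (cNorm R₀ H₀ blkE hG.lenle 1)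
      (E ∘ₗ 𝔬.G1 U ∘ₗ 𝔬.Qstar U)
      (fun y y' => (B₃ + θ' * (B₃ * (1 - θ * c)⁻¹) * c) * Real.exp (-((ρ' + σ) * g.dist y y'))) :=
    hasMaj_left_right hG hrow hθ' hB₃ hA₃ (by linarith) (by linarith) (by linarith) (by linarith) hKE hEQ hGQ hfix1
  have hBθ : 0 ≤ B₃ + θ' * (B₃ * (1 - θ * c)⁻¹) * c := add_nonneg hB₃ hθA₃
  have hK₂ : 0 ≤ B₃ * (B₃ * (B₀ * (1 - θ * c)⁻¹) * c) * c := mul_nonneg (mul_nonneg hB₃ hK₁) hc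
  have hC : HasMaj (cNorm R₀ H₀ 𝔬.blk hG.lenle 0) (cNorm R₀ H₀ blkE hG.lenle 1)
      ((E ∘ₗ 𝔬.G1 U ∘ₗ 𝔬.Qstar U) ∘ₗ (𝔬.C1 U ∘ₗ (𝔬.Q U ∘ₗ (𝔬.G1 U ∘ₗ LinearMap.id))))
      (fun y y' => (weightNorm (BlockNorm.ofBlocks (toB6 g R₀ H₀) 𝔬.blkZ) wZ fun y => (hwZ y).le).κ *
        (B₃ + θ' * (B₃ * (1 - θ * c)⁻¹) * c) *
        (B₃ * (B₃ * (B₀ * (1 - θ * c)⁻¹) * c) * c) * c * Real.exp (-(ρ' * g.dist y y'))) :=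
    hasMaj_comp_exp htri hG.dnn hrow hBθ hK₂ hρ' (by linarith) le_rfl hD1Q hCQG
  simp only [weightNorm_ofBlocks_κ, one_mul] at hC
  -- (e) assembling (3.153) with the left factor E
  have h := ((hD1.of_rate_le hG.dnn hCL (by linarith : ρ' ≤ ρ)).sub hB).sub hC
  rw [← E_GG_eq hI E] at h
  have hC0 : 0 ≤ constD313 (B₀ + θ' * (B₀ * (1 - θ * c)⁻¹) * c) θ' (B₀ * (1 - θ * c)⁻¹) (B₃ * (1 - θ * c)⁻¹) B₃ bH.κ c :=
    constD313_nonneg hCL hθ' hA₁ hA₃ hB₃ bH.κ_nonneg hc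
  have h2 : HasMaj (cNorm R₀ H₀ 𝔬.blk hG.lenle 0) (cNorm R₀ H₀ blkE hG.lenle 1) (E ∘ₗ 𝔬.GG U)
      (fun a b => constD313 (B₀ + θ' * (B₀ * (1 - θ * c)⁻¹) * c) θ' (B₀ * (1 - θ * c)⁻¹) (B₃ * (1 - θ * c)⁻¹) B₃ bH.κ c *
        Real.exp (-(ρ' * g.dist a b))) :=
    h.mono fun a b => le_of_eq (by simp only [constD313, toB6_dist]; ring)
  have h' := hasMajorantHom_of_hasMaj_cNorm hG (fun a b => mul_nonneg hC0 (Real.exp_nonneg _)) h2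
  refine hasMajorantHom_mono (g := toB6 g R₀ H₀) 𝔬.blk blkE h' fun a b => le_of_eq ?_
  simp only [wt, pow_zero, pow_one, inv_one, mul_one]
  ring

omit [Fintype P] in
/-- ★ **THEOREM 3.13, ENTRY (3.42)₂ FOR THE COMPONENT ∇_{U,ν}𝔊, PRINTED SHAPE, COARSE LETTERS RE-CLASSED** — `GG_entry1E_of_lettersZ` with E := ∇_{U,ν} =
`Dd U ν` (X → X): the E-entry of G₀ is `Thm33G0Dir.e1d ν`, the E-derivative of the step `StepDir.sDd1 ν` (constant θ_D), the E-letters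
`Letters313DMZ.dgQsd ∕ dgDHd`, the letters `Letters313Z ∕ Letters313DZ`:
|(∇_{U,ν}𝔊λ)(x)| ≦ C·Lʲη·e^{−ρ′d(y,y′)}|λ| for x ∈ Δ(y), supp λ ⊂ Δ(y′), C = `constD313 …` as for the bundled ∇_U𝔊 (`GG_entry1_of_letters`).
[cite: Balaban1985BackgroundPropagators, Thm 3.13 p.426 + (3.153) p.426 + (3.42) p.397 + (3.39) p.397] -/
theorem GG_entry1d_of_lettersZ (hG : GeoOK g) {𝔬 : Ops g B X Y Z W} (𝔭 : HolderProbes g B X Y PX PY)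
    {Dd Dds : B.Cfg → P → Module.End ℝ (X → ℝ)} {U : B.Cfg} {bHX : ℝ → BlockNorm (toB6 g R₀ H₀) (X → ℝ)}
    {bH : BlockNorm (toB6 g R₀ H₀) (W → ℝ)} {Bh Bi Bq : ℝ → ℝ} {Bi2 : ℝ → ℝ → ℝ}
    {θ θD θH B₀ B₃ δ₀ δ₃ δK ρ ρ' σ c : ℝ} (hrow : RowSum (toB6 g R₀ H₀) σ c) (hc : 0 ≤ c)
    (hθ : 0 ≤ θ) (hθD : 0 ≤ θD) (hB₀ : 0 ≤ B₀) (hB₃ : 0 ≤ B₃) (hσ : 0 ≤ σ) (hρ' : 0 ≤ ρ') (hρ'ρ : ρ' + 3 * σ ≤ ρ) (hρS : ρ ≤ δ₀)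
    (hρ₃ : ρ ≤ δ₃) (hρδ : ρ + σ ≤ δK) (hq : θ * c < 1)
    (hK : HasMaj (cNorm R₀ H₀ 𝔬.blk hG.lenle 2) (cNorm R₀ H₀ 𝔬.blk hG.lenle 2) (𝔬.G0 U ∘ₗ (𝔬.Tpi U + 𝔬.T2 U))
      (fun a b => θ * Real.exp (-(δK * g.dist a b))))
    (he0 : HasMajorant (g := toB6 g R₀ H₀) 𝔬.blk (𝔬.G0 U) (fun a b => B₀ * g.len a ^ 2 * Real.exp (-(δ₀ * g.dist a b))))
    (hH0 : Thm33G0Dir 𝔬 𝔭 Dd Dds R₀ H₀ bHX B₀ Bh Bi Bi2 δ₀ U)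
    (hSD : StepDir 𝔬 𝔭 Dd Dds R₀ H₀ bHX hG.lenle θD θH δK U)
    {wZ : g.Site → ℝ} {hwZ : ∀ y, 0 < wZ y}
    (hL : Letters313Z 𝔬 R₀ H₀ hG wZ hwZ B₃ δ₃ U) (hLD : Letters313DZ 𝔬 R₀ H₀ hG wZ hwZ B₃ δ₃ bH U)
    (hLDM : Letters313DMZ 𝔬 𝔭 Dd R₀ H₀ hG wZ hwZ B₃ Bq δ₃ bH U) (hI : Identities 𝔬 U) (ν : P) :
    HasMajorantHom (g := toB6 g R₀ H₀) 𝔬.blk 𝔬.blk (Dd U ν ∘ₗ 𝔬.GG U)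
      (fun a b => constD313 (B₀ + θD * (B₀ * (1 - θ * c)⁻¹) * c) θD (B₀ * (1 - θ * c)⁻¹) (B₃ * (1 - θ * c)⁻¹) B₃ bH.κ c *
        g.len a * Real.exp (-(ρ' * g.dist a b))) :=
  GG_entry1E_of_lettersZ hG hrow hc hθ hθD hB₀ hB₃ hσ hρ' hρ'ρ hρS hρ₃ hρδ hq hK he0 (hH0.e1d ν) (hSD.sDd1 ν) (hLDM.dgQsd ν)
    (hLDM.dgDHd ν) hL hLD.rgdH hI

end OneMember

end

end Literature.MathematicalPhysics.QuantumFieldTheory.Balaban1983to89.B9Thm313WholeDirZ
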